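import Summits.FinalStateConjecture.FinalStateConjecture.Theses.ExactKerrEnds
import Summits.FinalStateConjecture.FinalStateConjecture.Theorems.PhaseMixingCaptureWeakCosmicCensorshipMGHDCompleteNullInfinityInvariant
import Literature.Geometry.Lorentzian.CompleteDevelopmentMaximal
import Summits.FinalStateConjecture.FinalStateConjecture.Theorems.ExactKerrEndsSettlingAlongCensoredKerrEndsShape
import Literature.Geometry.Lorentzian.MinkowskiStabilityCauchy
import Literature.Geometry.Lorentzian.LeviCivitaProofs
import HarnessLib

/-!
# Route `ExactKerrEnds`, crux `CensorshipAlongKerrEnds` (stmt-FinalStateConjecture-18521):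
# censoredness from one geodesically complete development

The crux `CensorshipAlongKerrEnds` (relative positive-codimension weak cosmic censorship inside the
Kerr-ended class) asks, in its constant case, that through every admissible KERR-ENDED datum `d` pass
a tame, injective, immersed curve of admissible data whose members off `0` are Kerr-ended AND
CENSORED (every maximal vacuum Cauchy development has complete `𝓘⁺`, sojourn form). Censoredness of a
datum is a statement about ALL of its maximal vacuum Cauchy developments; the only mechanism by which
the tree certifies it is comparison with ONE explicit development: if some vacuum Cauchy development
`𝒟₀` of `d` is geodesically complete, every maximal one is isometric to it (as a development), so
censoredness of `d` is read off `𝒟₀`. This file records that interface, unconditionally: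

* `censored_of_isGeodesicallyComplete` — a datum one of whose vacuum Cauchy developments is
  geodesically complete with complete `𝓘⁺` is censored (general form of the landed
  `censored_of_cauchyDevelopment_eq_minkowski`, `ExactKerrEndsCensorshipAlongKerrEndsMinkowskiCensored.lean`,
  whose complete development is Minkowski space);
* `stub_censoredOfIsGeodesicallyComplete` — the same in the registry's expanded vocabulary
  (registered sub-goal of the crux item).

It is the entry point through which a global stability theorem producing geodesically complete
developments (stability of Minkowski space: Christodoulou–Klainerman 1993 / Bieri 2010, vendored over
`VacuumCauchyDevelopment` as the named fact `christodoulou_klainerman_stability_minkowski_cauchy`)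
yields the constant case of the crux near Minkowski data; that conditional corollary is appended to
this file once the named fact is in the tree. No dynamics is claimed here.

References: Choquet-Bruhat–Geroch, CMP 14 (1969), Thm. 3; O'Neill 1983, Ch. 7, Cor. 7.29;
Christodoulou, CQG 16 (1999) A23, pp. A26–A27.
-/

-- `Summit.FinalStateConjecture.FinalStateConjecture.…` repeats a namespace component by design (D-0017 layout)
set_option linter.dupNamespace false

noncomputable section

open Set Function
open scoped Manifold ContDiff Topology

namespace Summit.FinalStateConjecture.FinalStateConjecture.Theorems.ExactKerrEnds

open Literature.Geometry.Lorentzian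

section Complete

variable {X : Type} [TopologicalSpace X] [ChartedSpace E3 X] [IsManifold (𝓡 3) ∞ X] [ConnectedSpace X]
  {D : InitialDataSet (𝓡 3) X}

/-- **A datum with a geodesically complete vacuum Cauchy development having complete `𝓘⁺` is
CENSORED**: every maximal vacuum Cauchy development of it is isometric, as a development, to the
complete one (`VacuumCauchyDevelopment.IsMaximal.isIsometricTo_of_isGeodesicallyComplete`: the
complete development embeds into the maximal one by maximality, and an isometric embedding of a
geodesically complete connected Lorentz manifold into one of the same dimension is onto, O'Neill
1983, Cor. 7.29), and complete `𝓘⁺` (sojourn form) is an invariant of isometric developments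
(`hasCompleteNullInfinity_iff_of_isIsometricTo`). General form of the landed
`censored_of_cauchyDevelopment_eq_minkowski`; the interface through which any stability theorem
producing a geodesically complete development feeds the crux. Choquet-Bruhat–Geroch 1969, Thm. 3;
Christodoulou, CQG 16 (1999), pp. A26–A27. [cite: ChoquetBruhatGeroch1969CMP, Thm. 3 (pp. 332–334)] -/
theorem censored_of_isGeodesicallyComplete (𝒟₀ : VacuumCauchyDevelopment D)
    (hc : ∀ [𝒟₀.metric.toPseudoRiemannianMetric.HasLeviCivita],
      IsGeodesicallyComplete 𝒟₀.metric.toPseudoRiemannianMetric.leviCivita)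
    (h₀ : HasCompleteNullInfinity 𝒟₀.toCauchyDevelopment) :
    ∀ 𝒟 : VacuumCauchyDevelopment D, 𝒟.IsMaximal → HasCompleteNullInfinity 𝒟.toCauchyDevelopment :=
  fun _ h𝒟 ↦ (PhaseMixingCapture.WeakCosmicCensorshipMGHD.hasCompleteNullInfinity_iff_of_isIsometricTo _ _
    (h𝒟.isIsometricTo_of_isGeodesicallyComplete hc)).1 h₀

/-- **Registered sub-goal `stub_censoredOfIsGeodesicallyComplete` of the crux item
(stmt-FinalStateConjecture-18521)**: censoredness from one geodesically complete vacuum Cauchy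
development of complete `𝓘⁺`, in the registry's expanded vocabulary; it IS
`censored_of_isGeodesicallyComplete`. [cite: ChoquetBruhatGeroch1969CMP, Thm. 3 (pp. 332–334)] -/
theorem stub_censoredOfIsGeodesicallyComplete : ∀ (X : Type) [TopologicalSpace X] [ChartedSpace Literature.Geometry.Lorentzian.E3 X] [IsManifold (𝓡 3) ((⊤ : ℕ∞) : WithTop ℕ∞) X] [ConnectedSpace X] (D : Literature.Geometry.Lorentzian.InitialDataSet (𝓡 3) X) (𝒟₀ : Literature.Geometry.Lorentzian.VacuumCauchyDevelopment D), (∀ [𝒟₀.metric.toPseudoRiemannianMetric.HasLeviCivita], Literature.Geometry.Lorentzian.IsGeodesicallyComplete 𝒟₀.metric.toPseudoRiemannianMetric.leviCivita) → Summit.FinalStateConjecture.HasCompleteNullInfinity 𝒟₀.toCauchyDevelopment → ∀ 𝒟 : Literature.Geometry.Lorentzian.VacuumCauchyDevelopment D, 𝒟.IsMaximal → Summit.FinalStateConjecture.HasCompleteNullInfinity 𝒟.toCauchyDevelopment :=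
  fun _ _ _ _ _ _ 𝒟₀ hc h₀ ↦ censored_of_isGeodesicallyComplete 𝒟₀ hc h₀

end Complete

/-! ### Conditional on the named fact `christodoulou_klainerman_stability_minkowski_cauchy`: the crux near Minkowski data

Appended once the faithful stability-of-Minkowski fact over `VacuumCauchyDevelopment`
(`Literature/Geometry/Lorentzian/MinkowskiStabilityCauchy.lean`) was in the tree. -/

section NearMinkowski

open scoped ENNReal

/-- **CK-small maximal vacuum data on `ℝ³` are censored** (conditional on
`christodoulou_klainerman_stability_minkowski_cauchy`): for the `(s, δ, ε)` of the named fact, every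
solution `d` of the vacuum constraints on `Minkowski.slice`, maximal (`tr k = 0`), with CK fall-off on
`trivialAFEnd` and `ε`-close to the trivial datum in `H^s_δ × H^{s-1}_{δ+1}`, is censored — every
maximal vacuum Cauchy development has complete `𝓘⁺` in the sojourn form of the summit
(`Summit.FinalStateConjecture.HasCompleteNullInfinity`, definitionally the ported
`DataEmbedding.HasCompleteFutureNullInfinity` concluded by the fact). Christodoulou–Klainerman 1993,
Thm. 10.2.1; Bieri 2010, Thm. 1. [cite: Bieri2010JDG, Thm. 1 (arXiv p. 3)] -/
theorem censored_of_ckSmall (hCK : christodoulou_klainerman_stability_minkowski_cauchy) :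
    ∃ (s : ℕ) (δ ε : ℝ), 0 < ε ∧
      ∀ (d : InitialDataSet (𝓡 3) Minkowski.slice) [d.metric.HasLeviCivita],
        d.IsVacuumConstraintSolution → d.IsMaximalData →
        (∃ M : ℝ, trivialAFEnd.IsStronglyAsymptoticallyFlatCK d M) →
        InitialDataSet.dataWeightedSobolevEDist s δ d trivialData < ENNReal.ofReal ε →
        ∀ 𝒟 : VacuumCauchyDevelopment d, 𝒟.IsMaximal →
          HasCompleteNullInfinity 𝒟.toCauchyDevelopment := by
  obtain ⟨s, δ, -, k, ε, hε, H⟩ := hCK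
  refine ⟨s, δ, ε, hε, fun d _ hvac hmax hsaf hdist 𝒟 h𝒟 ↦ ?_⟩
  intro inst
  obtain ⟨-, hscri, -⟩ := H d hvac hmax hsaf hdist 𝒟 h𝒟
  exact hscri

/-- **THE CONSTANT CASE OF THE CRUX NEAR MINKOWSKI DATA** (conditional on
`christodoulou_klainerman_stability_minkowski_cauchy`): for the `(s, δ, ε)` of the named fact, through
every admissible datum `d` on `ℝ³ = Minkowski.slice` which is maximal, has CK fall-off on
`trivialAFEnd`, is `ε`-close to the trivial datum in `H^s_δ × H^{s-1}_{δ+1}` and is KERR-ENDED passes a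
tame, injective, immersed curve of admissible data all of whose members are Kerr-ended and censored
— the conclusion of `CensorshipAlongKerrEnds` at the base `d` (its constant case `F c = d`; legend
`KerrEnded = HasExactKerrEnd`, `InitialDataSet.hasExactKerrEnd_iff`): the datum is censored by
stability of Minkowski space (`censored_of_ckSmall`) and its breathing curve is the witness
(`kerrEndedCensoredSelfWitness`). For large data the constant case is the open positive-codimension
censorship problem in the Kerr-ended class (line `Sketch` of the crux). Christodoulou–Klainerman 1993,
Thm. 10.2.1; Bieri 2010, Thm. 1; Christodoulou, CQG 16 (1999), p. A24.
[cite: Bieri2010JDG, Thm. 1 (arXiv p. 3)] [cite: Christodoulou1999, p. A24] -/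
theorem censorshipAlongKerrEnds_constCase_of_ckSmall
    (hCK : christodoulou_klainerman_stability_minkowski_cauchy) :
    ∃ (s : ℕ) (δ ε : ℝ), 0 < ε ∧
      ∀ d ∈ admissibleVacuumData Minkowski.slice, d.IsMaximalData →
        (∃ M : ℝ, trivialAFEnd.IsStronglyAsymptoticallyFlatCK d M) →
        InitialDataSet.dataWeightedSobolevEDist s δ d trivialData < ENNReal.ofReal ε →
        d.HasExactKerrEnd →
        ∃ (e' : AFEnd Minkowski.slice)
          (F' : EuclideanSpace ℝ (Fin 1) → InitialDataSet (𝓡 3) Minkowski.slice),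
          InitialDataSet.IsTameDataFamily e' 1 F' ∧ F' 0 = d ∧ Injective F' ∧
            InitialDataSet.IsImmersedAtZero 1 F' ∧
            (∀ c, F' c ∈ admissibleVacuumData Minkowski.slice) ∧
              ∀ c, (F' c).HasExactKerrEnd ∧
                ∀ 𝒟 : VacuumCauchyDevelopment (F' c), 𝒟.IsMaximal →
                  HasCompleteNullInfinity 𝒟.toCauchyDevelopment := by
  obtain ⟨s, δ, ε, hε, H⟩ := censored_of_ckSmall hCK
  refine ⟨s, δ, ε, hε, fun d hd hmax hsaf hdist hKE ↦ ?_⟩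
  haveI : d.metric.HasLeviCivita := d.metric.hasLeviCivita
  exact kerrEndedCensoredSelfWitness hd hKE (H d hd.1.1 hmax hsaf hdist)

/-- **THE CRUX RESTRICTED TO CURVES WHOSE MEMBERS OFF `0` ARE CK-SMALL** (conditional on
`christodoulou_klainerman_stability_minkowski_cauchy`): for the `(s, δ, ε)` of the named fact, the
statement of `CensorshipAlongKerrEnds` at `X = Minkowski.slice` holds for every tame curve `F` of
admissible data, immersed-injective or constant, whose members off `0` are Kerr-ended AND lie in the
CK class (maximal, CK fall-off on `trivialAFEnd`, `ε`-close to the trivial datum in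
`H^s_δ × H^{s-1}_{δ+1}`): those members are censored outright (`censored_of_ckSmall`), so in the
immersed-injective case `F` itself is the answer, and in the constant case the base is Kerr-ended and
censored and its breathing curve is (`kerrEndedCensoredSelfWitness`). This is the one region of the
admissible class where the crux is a consequence of a printed theorem; everywhere else it is the open
positive-codimension censorship problem in the Kerr-ended class. Christodoulou–Klainerman 1993,
Thm. 10.2.1; Bieri 2010, Thm. 1; Christodoulou, CQG 16 (1999), p. A24.
[cite: Bieri2010JDG, Thm. 1 (arXiv p. 3)] [cite: Christodoulou1999, p. A24] -/
theorem censorshipAlongKerrEnds_of_ckSmallMembers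
    (hCK : christodoulou_klainerman_stability_minkowski_cauchy) :
    ∃ (s : ℕ) (δ ε : ℝ), 0 < ε ∧
      ∀ (e : AFEnd Minkowski.slice)
        (F : EuclideanSpace ℝ (Fin 1) → InitialDataSet (𝓡 3) Minkowski.slice),
        InitialDataSet.IsTameDataFamily e 1 F →
        (InitialDataSet.IsImmersedAtZero 1 F ∧ Injective F ∨ ∀ c, F c = F 0) →
        (∀ c, F c ∈ admissibleVacuumData Minkowski.slice) →
        (∀ c ≠ 0, (F c).HasExactKerrEnd) →
        (∀ c ≠ 0, (F c).IsMaximalData ∧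
            (∃ M : ℝ, trivialAFEnd.IsStronglyAsymptoticallyFlatCK (F c) M) ∧
            InitialDataSet.dataWeightedSobolevEDist s δ (F c) trivialData < ENNReal.ofReal ε) →
        ∃ (e' : AFEnd Minkowski.slice)
          (F' : EuclideanSpace ℝ (Fin 1) → InitialDataSet (𝓡 3) Minkowski.slice),
          InitialDataSet.IsTameDataFamily e' 1 F' ∧ F' 0 = F 0 ∧ Injective F' ∧
            InitialDataSet.IsImmersedAtZero 1 F' ∧
            (∀ c, F' c ∈ admissibleVacuumData Minkowski.slice) ∧
              ∀ c ≠ 0, (F' c).HasExactKerrEnd ∧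
                ∀ 𝒟 : VacuumCauchyDevelopment (F' c), 𝒟.IsMaximal →
                  HasCompleteNullInfinity 𝒟.toCauchyDevelopment := by
  obtain ⟨s, δ, ε, hε, H⟩ := censored_of_ckSmall hCK
  refine ⟨s, δ, ε, hε, fun e F hF halt hadm hKE hsmall ↦ ?_⟩
  have hcen : ∀ c ≠ 0, ∀ 𝒟 : VacuumCauchyDevelopment (F c), 𝒟.IsMaximal →
      HasCompleteNullInfinity 𝒟.toCauchyDevelopment := by
    intro c hc
    obtain ⟨hmax, hsaf, hdist⟩ := hsmall c hc
    haveI : (F c).metric.HasLeviCivita := (F c).metric.hasLeviCivita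
    exact H (F c) (hadm c).1.1 hmax hsaf hdist
  rcases halt with ⟨himm, hinj⟩ | hconst
  · exact ⟨e, F, hF, rfl, hinj, himm, hadm, fun c hc ↦ ⟨hKE c hc, hcen c hc⟩⟩
  · -- constant case: the base `F 0 = F c₁` (`c₁ ≠ 0`) is Kerr-ended and censored; breathe it
    have hc₁ : (EuclideanSpace.single (0 : Fin 1) (1 : ℝ) : EuclideanSpace ℝ (Fin 1)) ≠ 0 := by
      intro h
      have h' := congrArg (fun v : EuclideanSpace ℝ (Fin 1) ↦ v 0) h
      simp at h'
    have hKE₀ : (F 0).HasExactKerrEnd := by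
      rw [← hconst (EuclideanSpace.single 0 1)]; exact hKE _ hc₁
    have hcen₀ : ∀ 𝒟 : VacuumCauchyDevelopment (F 0), 𝒟.IsMaximal →
        HasCompleteNullInfinity 𝒟.toCauchyDevelopment := by
      rw [← hconst (EuclideanSpace.single 0 1)]; exact hcen _ hc₁
    obtain ⟨e', F', hF', h0, hinj, himm, hadm', hall⟩ :=
      kerrEndedCensoredSelfWitness (hadm 0) hKE₀ hcen₀
    exact ⟨e', F', hF', h0, hinj, himm, hadm', fun c _ ↦ hall c⟩

/-- **Registered sub-goal `stub_censorshipAlongKerrEndsOfCKSmallMembers` of the crux item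
(stmt-FinalStateConjecture-18521)**: the crux restricted to curves whose members off `0` are CK-small,
CONDITIONAL on the named fact `christodoulou_klainerman_stability_minkowski_cauchy` (first binder), in
the registry's expanded vocabulary; it IS `censorshipAlongKerrEnds_of_ckSmallMembers`.
[cite: Bieri2010JDG, Thm. 1 (arXiv p. 3)] -/
theorem stub_censorshipAlongKerrEndsOfCKSmallMembers : Literature.Geometry.Lorentzian.christodoulou_klainerman_stability_minkowski_cauchy → ∃ (s : ℕ) (δ ε : ℝ), 0 < ε ∧ ∀ (e : Literature.Geometry.Lorentzian.AFEnd Literature.Geometry.Lorentzian.Minkowski.slice) (F : EuclideanSpace ℝ (Fin 1) → Literature.Geometry.Lorentzian.InitialDataSet (𝓡 3) Literature.Geometry.Lorentzian.Minkowski.slice), Literature.Geometry.Lorentzian.InitialDataSet.IsTameDataFamily e 1 F → (Literature.Geometry.Lorentzian.InitialDataSet.IsImmersedAtZero 1 F ∧ Function.Injective F ∨ ∀ c, F c = F 0) → (∀ c, F c ∈ Literature.Geometry.Lorentzian.admissibleVacuumData Literature.Geometry.Lorentzian.Minkowski.slice) → (∀ c ≠ 0, (F c).HasExactKerrEnd)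 → (∀ c ≠ 0, (F c).IsMaximalData ∧ (∃ M : ℝ, Literature.Geometry.Lorentzian.trivialAFEnd.IsStronglyAsymptoticallyFlatCK (F c) M) ∧ Literature.Geometry.Lorentzian.InitialDataSet.dataWeightedSobolevEDist s δ (F c) Literature.Geometry.Lorentzian.trivialData < ENNReal.ofReal ε) → ∃ (e' : Literature.Geometry.Lorentzian.AFEnd Literature.Geometry.Lorentzian.Minkowski.slice) (F' : EuclideanSpace ℝ (Fin 1) → Literature.Geometry.Lorentzian.InitialDataSet (𝓡 3) Literature.Geometry.Lorentzian.Minkowski.slice), Literature.Geometry.Lorentzian.InitialDataSet.IsTameDataFamily e' 1 F' ∧ F' 0 = F 0 ∧ Function.Injective F' ∧ Literature.Geometry.Lorentzian.InitialDataSet.IsImmersedAtZero 1 F' ∧ (∀ c, F' c ∈ Literature.Geometry.Lorentzian.admissibleVacuumData Literature.Geometry.Lorentzian.Minkowski.slice) ∧ ∀ c ≠ 0, (F' c).HasExactKerrEnd ∧ ∀ 𝒟 : Literature.Geometry.Lorentzian.VacuumCauchyDevelopment (F' c), 𝒟.IsMaximal → Summit.FinalStateConjecture.HasCompleteNullInfinity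 𝒟.toCauchyDevelopment :=
  censorshipAlongKerrEnds_of_ckSmallMembers

end NearMinkowski

end Summit.FinalStateConjecture.FinalStateConjecture.Theorems.ExactKerrEnds

end
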